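import Summits.BirchSwinnertonDyer.BirchSwinnertonDyer.Theorems.SignedLowerHalvesSmallImageLowerHalfBothSignsRttD2TwistSemilinear
import Summits.BirchSwinnertonDyer.BirchSwinnertonDyer.Theorems.SignedLowerHalvesSmallImageLowerHalfBothSignsRttD2TwistThresholds
import HarnessLib

/-!
# Route `SignedLowerHalves`, crux L `SmallImageLowerHalfBothSigns` (stmt-BirchSwinnertonDyer-23599), line `rtt_w3` v14 — E2, row «D-tw-coh» part 2c(v):
# ONE-CALL PACKAGE — the twist equivalence from `θ' = θ on Gal(K̄/K̃_∞)` alone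

INPUTS hand `bsd-inputs-honda-p1` g23 (LEAD g11 RULING «U» (U5)). The thresholds of part 2c(iii) are CHOSEN (`thresholds`), so the consumer's binders are exactly:
the two pinned data `D, D'`, the congruence on inertia `hN` (both characters unramified outside `supp(p𝔣)`) and `hker : ∀ σ ∈ pairKer κ₁ κ₂, θ' σ = θ σ`
(`η = θ'/θ` is a character of `Gal(K̃_∞/K)`).
* `thresholds`, `thresholds_monotone`, `thresholds_spec`; ★★★ `twistEquivOfKer … hN hker D D' : D.H ≃+ D'.H`; ★★ `proj_twistEquivOfKer` (cofinal level components =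
  layer twists); ★★★ `twistEquivOfKer_smul` (full `σ`-semilinearity, `σ` a binder as in part 2c(iv), `i ≤ 2`); `hN_of_trivial` (the usual source of `hN`).
DEFS (`thresholds`, `twistEquivOfKer`) + THEOREMS; no named fact, no `sorry`; crux L, crux M, E2 and BSD remain OPEN and are proved for NO curve by any of this.
References: [Rubin2000] Ch. VI §6.1–6.2; [JohnsonLeungKings2011] §4.1–§4.2; [SerreGaloisCohomology1997] I §2.2.
-/

set_option autoImplicit false
-- the Theorems namespace of this sub repeats the summit name by design (D-0017 nested layout)
set_option linter.dupNamespace false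

noncomputable section

open scoped NumberField
open CategoryTheory Field IsDedekindDomain
open Literature.NumberTheory.GaloisRepresentations
open Literature.NumberTheory.EllipticCurves
open Literature.NumberTheory.ComplexMultiplication.EllipticUnits
open Literature.NumberTheory.ComplexMultiplication.EllipticUnits.JohnsonLeungKings2011

namespace Summit.BirchSwinnertonDyer.BirchSwinnertonDyer.Theorems.SmallImageRttD2Twist

variable {K : Type} [Field K] [NumberField K] {p : ℕ} [Fact p.Prime] (S : Set (PadicAlgCl p))
  (κ₁ κ₂ : ZpExtension K p) {γ₁ γ₂ γ₁' γ₂' : absoluteGaloisGroup K} (θ θ' : absoluteGaloisGroup K →ₜ* (padicCoeffIntegers S)ˣ)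
  (𝔣 : Ideal (𝓞 K)) {i : ℕ}

omit [NumberField K] in
/-- The usual source of the inertia congruence `hN`: both characters are trivial on `N_S`. [cite: JohnsonLeungKings2011, §2.1 Def. 2.1 (arXiv p0006:L36–41)] -/
theorem hN_of_trivial {N : Subgroup (absoluteGaloisGroup K)} (hθ : ∀ σ ∈ N, θ σ = 1) (hθ' : ∀ σ ∈ N, θ' σ = 1) (k : ℕ) :
    ∀ σ ∈ N, ∃ b : padicCoeffIntegers S,
      ((θ' σ : (padicCoeffIntegers S)ˣ) : padicCoeffIntegers S) = (θ σ : (padicCoeffIntegers S)ˣ) + ((p : padicCoeffIntegers S)) ^ k * b :=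
  fun σ hσ ↦ ⟨0, by rw [hθ σ hσ, hθ' σ hσ, mul_zero, add_zero]⟩

section Ker

variable (hker : ∀ σ ∈ ZpExtension.pairKer κ₁ κ₂, θ' σ = θ σ)

/-- **The chosen thresholds** `m(k)` of part 2c(iii) (`exists_thresholds`). [cite: SerreGaloisCohomology1997, I §2.2 Prop. 8] -/
def thresholds : ℕ → ℕ := (exists_thresholds S κ₁ κ₂ θ θ' hker).choose

/-- The chosen thresholds are monotone. [cite: SerreGaloisCohomology1997, I §2.2 Prop. 8] -/
theorem thresholds_monotone : Monotone (thresholds S κ₁ κ₂ θ θ' hker) := (exists_thresholds S κ₁ κ₂ θ θ' hker).choose_spec.1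

/-- The chosen thresholds work: `θ' ≡ θ (mod p^k)` on `Gal(K̄/K̃_{m(k)})`. [cite: SerreGaloisCohomology1997, I §2.2 Prop. 8] -/
theorem thresholds_spec : ∀ k, ∀ σ ∈ JohnsonLeungKings2011.pairLayerSubgroup κ₁ κ₂ (thresholds S κ₁ κ₂ θ θ' hker k), ∃ b : padicCoeffIntegers S,
    ((θ' σ : (padicCoeffIntegers S)ˣ) : padicCoeffIntegers S) = (θ σ : (padicCoeffIntegers S)ˣ) + ((p : padicCoeffIntegers S)) ^ k * b :=
  (exists_thresholds S κ₁ κ₂ θ θ' hker).choose_spec.2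

variable (hN : ∀ k, ∀ σ ∈ ramificationSubgroup K (suppPF p 𝔣), ∃ b : padicCoeffIntegers S,
    ((θ' σ : (padicCoeffIntegers S)ˣ) : padicCoeffIntegers S) = (θ σ : (padicCoeffIntegers S)ˣ) + ((p : padicCoeffIntegers S)) ^ k * b)
  (D : IwasawaCohomologyDataO S κ₁ κ₂ γ₁ γ₂ θ 𝔣 i) (D' : IwasawaCohomologyDataO S κ₁ κ₂ γ₁' γ₂' θ' 𝔣 i)

/-- ★★★ **ONE CALL — the twist equivalence `H^i(𝒪_K[1/p𝔣], Λ_𝒪(θ)(1)) ≃+ H^i(𝒪_K[1/p𝔣], Λ_𝒪(θ')(1))` on the pinned data** from `θ' = θ` on `Gal(K̄/K̃_∞)`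
and on `N_S` (mod every `p^k`). [cite: Rubin2000, Ch. VI §6.1–6.2] [cite: JohnsonLeungKings2011, Def. 4.2 (94) (arXiv p0012:L94)] -/
def twistEquivOfKer : D.H ≃+ D'.H :=
  twistEquiv S κ₁ κ₂ θ θ' 𝔣 (thresholds S κ₁ κ₂ θ θ' hker) (thresholds_monotone S κ₁ κ₂ θ θ' hker) hN
    (thresholds_spec S κ₁ κ₂ θ θ' hker) D D'

/-- Unfolding `twistEquivOfKer`. [cite: Rubin2000, Ch. VI §6.1–6.2] -/
theorem twistEquivOfKer_apply (x : D.H) :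
    twistEquivOfKer S κ₁ κ₂ θ θ' 𝔣 hker hN D D' x =
      twistHom S κ₁ κ₂ θ θ' 𝔣 (thresholds S κ₁ κ₂ θ θ' hker) (thresholds_monotone S κ₁ κ₂ θ θ' hker) hN
        (thresholds_spec S κ₁ κ₂ θ θ' hker) D D' x := rfl

/-- ★★ **Cofinal level components of the packaged twist are the layer twists.** [cite: Rubin2000, Ch. VI §6.1–6.2] -/
theorem proj_twistEquivOfKer {n k : ℕ} (hn : thresholds S κ₁ κ₂ θ θ' hker k ≤ n) (x : D.H) :
    D'.proj n k (twistEquivOfKer S κ₁ κ₂ θ θ' 𝔣 hker hN D D' x) =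
      layerTwistO S κ₁ κ₂ θ θ' 𝔣 (thresholds S κ₁ κ₂ θ θ' hker) hN (thresholds_spec S κ₁ κ₂ θ θ' hker) n k i hn (D.proj n k x) :=
  proj_twistHom S κ₁ κ₂ θ θ' 𝔣 (thresholds S κ₁ κ₂ θ θ' hker) (thresholds_monotone S κ₁ κ₂ θ θ' hker) hN
    (thresholds_spec S κ₁ κ₂ θ θ' hker) D D' hn x

end Ker

/-- ★★★ **FULL SEMILINEARITY of the packaged twist** (same pins on both data; `σ` a ring endomorphism of `Λ_{𝒪,2}` fixing constants with
`σ(T_i) = u_i(1 + T_i) − 1`, `u_i = θ(γ_i)θ'(γ_i)⁻¹`; `i ≤ 2`): `e (F • x) = σ F • e x` for every `F`. [cite: Rubin2000, Ch. VI §6.1–6.2] [cite: JohnsonLeungKings2011, §4.1–§4.2 (arXiv p0012:L39–112)] -/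
theorem twistEquivOfKer_smul (hi : i ≤ 2) (hker : ∀ σ ∈ ZpExtension.pairKer κ₁ κ₂, θ' σ = θ σ)
    (hN : ∀ k, ∀ σ ∈ ramificationSubgroup K (suppPF p 𝔣), ∃ b : padicCoeffIntegers S,
      ((θ' σ : (padicCoeffIntegers S)ˣ) : padicCoeffIntegers S) = (θ σ : (padicCoeffIntegers S)ˣ) + ((p : padicCoeffIntegers S)) ^ k * b)
    (D : IwasawaCohomologyDataO S κ₁ κ₂ γ₁ γ₂ θ 𝔣 i) (D₁ : IwasawaCohomologyDataO S κ₁ κ₂ γ₁ γ₂ θ' 𝔣 i)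
    (σ : IwasawaAlgebraO₂ S →+* IwasawaAlgebraO₂ S)
    (hσC : ∀ c : padicCoeffIntegers S,
      σ (PowerSeries.C (PowerSeries.C c : PowerSeries (padicCoeffIntegers S))) = PowerSeries.C (PowerSeries.C c : PowerSeries (padicCoeffIntegers S)))
    (hσX : σ PowerSeries.X =
      (PowerSeries.C (PowerSeries.C (((θ γ₁ * (θ' γ₁)⁻¹ : (padicCoeffIntegers S)ˣ)) : padicCoeffIntegers S) :
          PowerSeries (padicCoeffIntegers S)) : IwasawaAlgebraO₂ S) * (1 + PowerSeries.X) - 1)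
    (hσCX : σ (PowerSeries.C (PowerSeries.X : PowerSeries (padicCoeffIntegers S))) =
      (PowerSeries.C (PowerSeries.C (((θ γ₂ * (θ' γ₂)⁻¹ : (padicCoeffIntegers S)ˣ)) : padicCoeffIntegers S) :
          PowerSeries (padicCoeffIntegers S)) : IwasawaAlgebraO₂ S) *
        (1 + (PowerSeries.C (PowerSeries.X : PowerSeries (padicCoeffIntegers S)) : IwasawaAlgebraO₂ S)) - 1)
    (F : IwasawaAlgebraO₂ S) (x : D.H) :
    twistEquivOfKer S κ₁ κ₂ θ θ' 𝔣 hker hN D D₁ (F • x) = σ F • twistEquivOfKer S κ₁ κ₂ θ θ' 𝔣 hker hN D D₁ x :=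
  twistHom_smul S κ₁ κ₂ θ θ' 𝔣 hi (thresholds S κ₁ κ₂ θ θ' hker) (thresholds_monotone S κ₁ κ₂ θ θ' hker) hN
    (thresholds_spec S κ₁ κ₂ θ θ' hker) D D₁ σ hσC hσX hσCX F x

end Summit.BirchSwinnertonDyer.BirchSwinnertonDyer.Theorems.SmallImageRttD2Twist

end
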